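import Summits.NavierStokesRegularity.NavierStokesRegularity.Theorems.OddMorawetzLocal.Negative.OddMorawetzLocalRefutationData5
import Summits.NavierStokesRegularity.NavierStokesRegularity.Theorems.OddMorawetzLocal.Negative.OddMorawetzLocalRefutationDefsFast
import Summits.NavierStokesRegularity.NavierStokesRegularity.Theorems.OddMorawetzLocal.Negative.OddMorawetzLocalEvaluatorDefs
import HarnessLib

/-!
# Crux `OddMorawetzLocal` (stmt-NavierStokesRegularity-1376) — kernel values of the live densities (part 5A12)

The exact evaluation, by the kernel (`decide +kernel`) on the evaluator vocabulary `OddMorawetzLocalEvaluatorDefs`, of the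
Morawetz pairing `Q_p(v)/(π√π)` of the live weight-5 density `f_A` (contraction of shape (0,2,3), 54 terms) at the explicit divergence-free odd
polynomial-Gaussian field(s) u₁ = (−2x₁, 2x₀, 0)e^{-|x|²}, u₂ = (−2x₀²x₁, −2x₀+2x₀³, 0)e^{-|x|²}: each theorem states `evalRes 1000 (chunk) field = (true, value)` for a chunk of
18 terms of the density (the flag certifies divergence-freeness of the field, success and evenness of the Hermite
expansions and evenness of the local product; the pairing is additive in the terms, so `Q_p(v) = (Σ chunk values)·π√π`
by the soundness theorem `morawetzPairing_pgv_eq`). Totals: u1: -5/8; u2: 87248443/164003840.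
No analysis; lands `--supports` the crux item; consumed by the weight-5 assembly of the refutation.
-/

set_option linter.dupNamespace false

namespace Summit.NavierStokesRegularity.NavierStokesRegularity.Theorems.OddMorawetz

/-- `Q/(π√π)` contribution of the terms `0 … 17` of `f_A` at u1: `-5/16` (flag `true`). -/
theorem val5_A_u1_0 : evalRes 1000 (((isoPolyF (isoDesc5.getD 0 (.poly []))).drop 0).take 18) (![[(-2, 0, 1, 0)], [(2, 1, 0, 0)], []] : EField) =
    (true, (-5/16 : ℚ)) := by
  decide +kernel

/-- `Q/(π√π)` contribution of the terms `18 … 35` of `f_A` at u1: `3043/6160` (flag `true`). -/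
theorem val5_A_u1_1 : evalRes 1000 (((isoPolyF (isoDesc5.getD 0 (.poly []))).drop 18).take 18) (![[(-2, 0, 1, 0)], [(2, 1, 0, 0)], []] : EField) =
    (true, (3043/6160 : ℚ)) := by
  decide +kernel

/-- `Q/(π√π)` contribution of the terms `36 … 53` of `f_A` at u1: `-621/770` (flag `true`). -/
theorem val5_A_u1_2 : evalRes 1000 (((isoPolyF (isoDesc5.getD 0 (.poly []))).drop 36).take 18) (![[(-2, 0, 1, 0)], [(2, 1, 0, 0)], []] : EField) =
    (true, (-621/770 : ℚ)) := by
  decide +kernel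

/-- `Q/(π√π)` contribution of the terms `0 … 17` of `f_A` at u2: `38964521/196804608` (flag `true`). -/
theorem val5_A_u2_0 : evalRes 1000 (((isoPolyF (isoDesc5.getD 0 (.poly []))).drop 0).take 18) (![[(-2, 2, 1, 0)], [(-2, 1, 0, 0), (2, 3, 0, 0)], []] : EField) =
    (true, (38964521/196804608 : ℚ)) := by
  decide +kernel

/-- `Q/(π√π)` contribution of the terms `18 … 35` of `f_A` at u2: `49387881757/105946480640` (flag `true`). -/
theorem val5_A_u2_1 : evalRes 1000 (((isoPolyF (isoDesc5.getD 0 (.poly []))).drop 18).take 18) (![[(-2, 2, 1, 0)], [(-2, 1, 0, 0), (2, 3, 0, 0)], []] : EField) =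
    (true, (49387881757/105946480640 : ℚ)) := by
  decide +kernel

/-- `Q/(π√π)` contribution of the terms `36 … 53` of `f_A` at u2: `-5250483019/39729930240` (flag `true`). -/
theorem val5_A_u2_2 : evalRes 1000 (((isoPolyF (isoDesc5.getD 0 (.poly []))).drop 36).take 18) (![[(-2, 2, 1, 0)], [(-2, 1, 0, 0), (2, 3, 0, 0)], []] : EField) =
    (true, (-5250483019/39729930240 : ℚ)) := by
  decide +kernel

end Summit.NavierStokesRegularity.NavierStokesRegularity.Theorems.OddMorawetz
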